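import Summits.HubbardSuperconductivity.HubbardSuperconductivity.Theorems.ThermalWedgeTwSeededEnsembleEquivalenceRChordFreeCalibration

/-!
# Reduction theorem: `TwSeededEnsembleEquivalenceR` from TANGENT ≤ CHORD for the sourced pair response
# (crux stmt-HubbardSuperconductivity-15581, line `Sketch` v8.5; pool seat 0, session 74)

Support file (`--supports stmt-HubbardSuperconductivity-15581`; sorry-free; no definition).

`…RChordReduction.lean` (p148057) reduced the crux to FV-CHORD: the chord pair amplitude `c_L(h) = Re⟨Q⟩_h / h`
(`Q = Δ_d + Δ_dᴴ`, `⟨·⟩_h` the Gibbs state of `dWaveSourceTorus L U μ h` at `β = e^{a/U}`) is non-increasing on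
`(0, 13g+1]`, eventually in `L`. Since `h ↦ Re⟨Q⟩_h` is `C¹` with derivative `β·b_L(h)`,
`b_L(h) = Re (Q,Q)^{Duh}_h − (Re⟨Q⟩_h)²` the truncated Duhamel (Kubo–Mori–Bogoliubov) pair susceptibility at source `h`
(`chr_hasDerivAt_pairAmplitude`), monotonicity of the chord is a POINTWISE inequality between two standard correlation
functions of the sourced Gibbs state, with no derivative, limit, or convexity notion left in the statement:

  FV-TANGENT:  `β · b_L(h) · h ≤ Re⟨Q⟩_h`  for `0 < h < 13g+1`   (differential pair susceptibility ≤ chord pair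
  susceptibility; "the tangent lies below the chord" for the pair-amplitude curve through the origin).

* `tgr_hasDerivAt_chord` — `c_L′(h) = (β b_L(h) h − Re⟨Q⟩_h)/h²` for `h ≠ 0`.
* `tgr_fvTangent_iff_fvChord` — torus by torus, `β > 0`, any `R`: FV-TANGENT on `(0, R)` ⟺ FV-CHORD on `(0, R]`
  (`antitoneOn_of_deriv_nonpos`; conversely `AntitoneOn.derivWithin_nonpos` on the open interval). With
  `chr_fvChord_iff_fvConcavity` all three finite-volume forms FV-TANGENT ⟺ FV-CHORD ⟺ FV-CONC coincide.
* `twR_of_fvTangentLeChord` — **FV-TANGENT (eventually in `L`, at `β = e^{a/U}`) ⟹ R**, no use of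
  `TwSourcedCondensation` (stmt-1697).
* `tgr_truncatedSusceptibility_nonneg`, `tgr_pairAmplitude_nonneg` — `b_L(h) ≥ 0` (DLS) and `Re⟨Q⟩_h ≥ 0` for `h ≥ 0`
  (the pair amplitude is non-decreasing from `Re⟨Q⟩_0 = 0`): both sides of FV-TANGENT are non-negative.
* `cal_freeTangentLeChord` — FV-TANGENT at `U = 0` for every `β > 0`, `μ`, `L ≥ 3` and every `h > 0`
  (`cal_freeChordMonotone_finiteVolume`).

[folklore composition]
-/

set_option linter.dupNamespace false

namespace Summit.HubbardSuperconductivity.HubbardSuperconductivity.Theorems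

open Matrix Set Literature.MathematicalPhysics.QuantumLattice
open Summit.HubbardSuperconductivity.HubbardSuperconductivity.Theses.ThermalWedge
open scoped ComplexOrder

noncomputable section

/-! ### The chord and its derivative -/

/-- **`c_L′(h) = (β b_L(h) h − Re⟨Q⟩_h)/h²` for `h ≠ 0`**, `c_L(h) = Re⟨Q⟩_h / h` the chord pair amplitude
(quotient rule on `chr_hasDerivAt_pairAmplitude`). [folklore] -/
theorem tgr_hasDerivAt_chord (L : ℕ) [NeZero L] (U μ : ℝ) {β : ℝ} (hβ : 0 < β) {h : ℝ} (hh : h ≠ 0) :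
    HasDerivAt (fun t : ℝ => (gibbsState β (dWaveSourceTorus L U μ t)
        (pairField dWaveFormFactor L + (pairField dWaveFormFactor L)ᴴ)).re / t)
      ((β * ((duhamel β (dWaveSourceTorus L U μ h)
              (pairField dWaveFormFactor L + (pairField dWaveFormFactor L)ᴴ)
              (pairField dWaveFormFactor L + (pairField dWaveFormFactor L)ᴴ)).re -
            (gibbsState β (dWaveSourceTorus L U μ h)
              (pairField dWaveFormFactor L + (pairField dWaveFormFactor L)ᴴ)).re ^ 2) * h -
          (gibbsState β (dWaveSourceTorus L U μ h)
            (pairField dWaveFormFactor L + (pairField dWaveFormFactor L)ᴴ)).re) / h ^ 2) h := by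
  have h1 := (chr_hasDerivAt_pairAmplitude L U μ hβ h).fun_div (hasDerivAt_id' h) hh
  simpa only [mul_one] using h1

/-! ### FV-TANGENT ⟺ FV-CHORD, torus by torus -/

/-- **Tangent below chord ⟺ non-increasing chords.** For every finite torus, `β > 0` and real `R`:
`β b_L(h) h ≤ Re⟨Q⟩_h` for all `h ∈ (0, R)` iff `h ↦ Re⟨Q⟩_h / h` is non-increasing on `(0, R]`
(`b_L` the truncated Duhamel pair susceptibility, `Q = Δ_d + Δ_dᴴ`). [folklore composition] -/
theorem tgr_fvTangent_iff_fvChord (L : ℕ) [NeZero L] (U μ : ℝ) {β : ℝ} (R : ℝ) (hβ : 0 < β) :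
    (∀ h ∈ Set.Ioo 0 R,
      β * ((duhamel β (dWaveSourceTorus L U μ h)
              (pairField dWaveFormFactor L + (pairField dWaveFormFactor L)ᴴ)
              (pairField dWaveFormFactor L + (pairField dWaveFormFactor L)ᴴ)).re -
            (gibbsState β (dWaveSourceTorus L U μ h)
              (pairField dWaveFormFactor L + (pairField dWaveFormFactor L)ᴴ)).re ^ 2) * h ≤
        (gibbsState β (dWaveSourceTorus L U μ h)
          (pairField dWaveFormFactor L + (pairField dWaveFormFactor L)ᴴ)).re) ↔
    AntitoneOn (fun h : ℝ => (gibbsState β (dWaveSourceTorus L U μ h)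
        (pairField dWaveFormFactor L + (pairField dWaveFormFactor L)ᴴ)).re / h) (Set.Ioc 0 R) := by
  set Q := pairField dWaveFormFactor L + (pairField dWaveFormFactor L)ᴴ with hQ
  set m : ℝ → ℝ := fun t => (gibbsState β (dWaveSourceTorus L U μ t) Q).re with hm
  set b : ℝ → ℝ := fun t => (duhamel β (dWaveSourceTorus L U μ t) Q Q).re -
    (gibbsState β (dWaveSourceTorus L U μ t) Q).re ^ 2 with hb
  have hder : ∀ t : ℝ, t ≠ 0 → HasDerivAt (fun t => m t / t) ((β * b t * t - m t) / t ^ 2) t :=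
    fun t ht => tgr_hasDerivAt_chord L U μ hβ ht
  constructor
  · intro htan
    refine antitoneOn_of_deriv_nonpos (convex_Ioc 0 R) ?_ ?_ ?_
    · exact fun t ht => (hder t ht.1.ne').continuousAt.continuousWithinAt
    · rw [interior_Ioc]
      exact fun t ht => (hder t ht.1.ne').differentiableAt.differentiableWithinAt
    · rw [interior_Ioc]
      intro t ht
      rw [(hder t ht.1.ne').deriv]
      have hnum : β * b t * t - m t ≤ 0 := by linarith [htan t ht]
      exact div_nonpos_iff.2 (Or.inr ⟨hnum, by positivity⟩)
  · intro hanti t ht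
    have h1 := (hanti.mono Set.Ioo_subset_Ioc_self).derivWithin_nonpos (x := t)
    rw [derivWithin_of_isOpen isOpen_Ioo ht, (hder t ht.1.ne').deriv] at h1
    have h2 := (div_le_iff₀ (pow_pos ht.1 2)).1 h1
    simp only [hm, hb] at h2
    linarith

/-! ### FV-TANGENT ⟹ R -/

/-- **FV-TANGENT ⟹ R (no use of `TwSourcedCondensation`).** If on every window `[μ₁, μ₂] ⊂ (−4, 0)` there are
`a, K', U₀ > 0` such that for `U ∈ (0, U₀]`, `g ∈ [K'U, 1/10]`, interior `μ`, eventually in `L`, and every source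
`h ∈ (0, 13g+1)`, the cold sourced torus at `β = e^{a/U}` satisfies
`β · [Re (Q,Q)^{Duh}_h − (Re⟨Q⟩_h)²] · h ≤ Re⟨Q⟩_h` (`Q = Δ_d + Δ_dᴴ`: differential pair susceptibility at most the
chord pair susceptibility), then `TwSeededEnsembleEquivalenceR`
(`tgr_fvTangent_iff_fvChord` ∘ `twR_of_fvChordMonotone`). [folklore composition] -/
theorem twR_of_fvTangentLeChord :
    (∀ (μ₁ μ₂ : ℝ), -4 < μ₁ → μ₁ < μ₂ → μ₂ < 0 → ∃ a K' U₀ : ℝ, 0 < a ∧ 0 < K' ∧ 0 < U₀ ∧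
      ∀ U ∈ Set.Ioc (0 : ℝ) U₀, ∀ g ∈ Set.Icc (K' * U) (1 / 10), ∀ μ ∈ Set.Ioo μ₁ μ₂,
        ∃ L₀ : ℕ, ∀ (L : ℕ) [NeZero L], L₀ ≤ L → ∀ h ∈ Set.Ioo (0 : ℝ) (13 * g + 1),
          Real.exp (a / U) *
              ((Matrix.duhamel (Real.exp (a / U)) (dWaveSourceTorus L U μ h)
                  (pairField dWaveFormFactor L + (pairField dWaveFormFactor L)ᴴ)
                  (pairField dWaveFormFactor L + (pairField dWaveFormFactor L)ᴴ)).re -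
                (Matrix.gibbsState (Real.exp (a / U)) (dWaveSourceTorus L U μ h)
                  (pairField dWaveFormFactor L + (pairField dWaveFormFactor L)ᴴ)).re ^ 2) * h ≤
            (Matrix.gibbsState (Real.exp (a / U)) (dWaveSourceTorus L U μ h)
              (pairField dWaveFormFactor L + (pairField dWaveFormFactor L)ᴴ)).re) →
    TwSeededEnsembleEquivalenceR := by
  intro hTAN
  refine twR_of_fvChordMonotone fun μ₁ μ₂ h4 h12 h0 => ?_
  obtain ⟨a, K', U₀, ha, hK', hU₀, hA⟩ := hTAN μ₁ μ₂ h4 h12 h0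
  refine ⟨a, K', U₀, ha, hK', hU₀, fun U hU g hg μ hμ => ?_⟩
  obtain ⟨L₀, hL₀⟩ := hA U hU g hg μ hμ
  refine ⟨L₀, fun L _ hL => ?_⟩
  exact (tgr_fvTangent_iff_fvChord L U μ (13 * g + 1) (Real.exp_pos _)).mp (hL₀ L hL)

/-! ### Both sides of FV-TANGENT are non-negative -/

/-- **`b_L(h) ≥ 0`**: the truncated Duhamel pair susceptibility `Re (Q,Q)^{Duh}_h − (Re⟨Q⟩_h)²` is the Duhamel
self-function of the centred observable `Q − ⟨Q⟩_h` (`duhamel_sub_smul_one`), hence non-negative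
(`IsHermitian.re_duhamel_self_nonneg`). [cite: DLS1978, Thm. 3.1] -/
theorem tgr_truncatedSusceptibility_nonneg (L : ℕ) [NeZero L] (U μ β h : ℝ) :
    0 ≤ (duhamel β (dWaveSourceTorus L U μ h)
          (pairField dWaveFormFactor L + (pairField dWaveFormFactor L)ᴴ)
          (pairField dWaveFormFactor L + (pairField dWaveFormFactor L)ᴴ)).re -
        (gibbsState β (dWaveSourceTorus L U μ h)
          (pairField dWaveFormFactor L + (pairField dWaveFormFactor L)ᴴ)).re ^ 2 := by
  set H := dWaveSourceTorus L U μ h with hH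
  set Q := pairField dWaveFormFactor L + (pairField dWaveFormFactor L)ᴴ with hQ
  have hHh : H.IsHermitian :=
    isHermitian_sub_smul (isHermitian_hubbardTorusWith L 1 U μ) (isHermitian_pairField_add_conjTranspose L) h
  have hQh : Q.IsHermitian := isHermitian_pairField_add_conjTranspose L
  set c : ℝ := (gibbsState β H Q).re with hc
  have hcQ : gibbsState β H Q = (c : ℂ) := gibbsState_eq_re hHh β hQh
  have hcen : (Q - (c : ℂ) • (1 : Matrix _ _ ℂ)).IsHermitian := hQh.sub (isHermitian_real_smul isHermitian_one c)
  have hnn := hHh.re_duhamel_self_nonneg hcen β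
  rw [duhamel_sub_smul_one hHh β Q (c : ℂ), hcQ] at hnn
  have e : (duhamel β H Q Q - 2 * (c : ℂ) * (c : ℂ) + (c : ℂ) ^ 2).re = (duhamel β H Q Q).re - c ^ 2 := by
    simp only [Complex.sub_re, Complex.add_re]
    norm_cast
    ring
  rwa [e] at hnn

/-- **`Re⟨Q⟩_h ≥ 0` for `h ≥ 0`**: the pair amplitude has non-negative derivative `β b_L` and vanishes at `h = 0`
(`chr_pairAmplitude_zero`), so it is non-negative for non-negative sources (`monotoneOn_of_deriv_nonneg`). [folklore] -/
theorem tgr_pairAmplitude_nonneg (L : ℕ) [NeZero L] (U μ : ℝ) {β : ℝ} (hβ : 0 < β) {h : ℝ} (hh : 0 ≤ h) :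
    0 ≤ (gibbsState β (dWaveSourceTorus L U μ h)
        (pairField dWaveFormFactor L + (pairField dWaveFormFactor L)ᴴ)).re := by
  set m : ℝ → ℝ := fun t => (gibbsState β (dWaveSourceTorus L U μ t)
      (pairField dWaveFormFactor L + (pairField dWaveFormFactor L)ᴴ)).re with hm
  have hder := fun t : ℝ => chr_hasDerivAt_pairAmplitude L U μ hβ t
  have hmono : MonotoneOn m (Set.Ici 0) := by
    refine monotoneOn_of_deriv_nonneg (convex_Ici 0) ?_ ?_ ?_
    · exact fun t _ => (hder t).continuousAt.continuousWithinAt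
    · exact fun t _ => (hder t).differentiableAt.differentiableWithinAt
    · intro t _
      rw [(hder t).deriv]
      exact mul_nonneg hβ.le (tgr_truncatedSusceptibility_nonneg L U μ β t)
  have h0 : m 0 = 0 := chr_pairAmplitude_zero L U μ hβ
  have := hmono (Set.mem_Ici.2 le_rfl) (Set.mem_Ici.2 hh) hh
  rwa [h0] at this

/-! ### Calibration at `U = 0` -/

/-- **FV-TANGENT at `U = 0`** (every `β > 0`, `μ`, `L ≥ 3`, every `h > 0`): the free differential pair
susceptibility times the source is at most the free pair amplitude (`cal_freeChordMonotone_finiteVolume` through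
`tgr_fvTangent_iff_fvChord` on `(0, 2h]`). [folklore composition] -/
theorem cal_freeTangentLeChord (β μ : ℝ) (hβ : 0 < β) (L : ℕ) [NeZero L] (hL : 3 ≤ L) {h : ℝ} (hh : 0 < h) :
    β * ((duhamel β (dWaveSourceTorus L 0 μ h)
            (pairField dWaveFormFactor L + (pairField dWaveFormFactor L)ᴴ)
            (pairField dWaveFormFactor L + (pairField dWaveFormFactor L)ᴴ)).re -
          (gibbsState β (dWaveSourceTorus L 0 μ h)
            (pairField dWaveFormFactor L + (pairField dWaveFormFactor L)ᴴ)).re ^ 2) * h ≤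
      (gibbsState β (dWaveSourceTorus L 0 μ h)
        (pairField dWaveFormFactor L + (pairField dWaveFormFactor L)ᴴ)).re := by
  have hanti := (cal_freeChordMonotone_finiteVolume β μ hβ L hL).mono
    (fun t (ht : t ∈ Set.Ioc 0 (2 * h)) => ht.1)
  exact (tgr_fvTangent_iff_fvChord L 0 μ (2 * h) hβ).mpr hanti h ⟨hh, by linarith⟩

end

end Summit.HubbardSuperconductivity.HubbardSuperconductivity.Theorems
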